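import Summits.Ventures.HodgeRepro2.T5RecordSatakeCell
import Summits.Ventures.HodgeRepro2.T5HeckeConjugationTransport
import Summits.Ventures.HodgeRepro2.T5InertDegreeAdicCompletion

/-!
# The degree of the explicit generator on the record's pair: `deg T_{g₀} = N(v)⁴ + N(v)`

Tier-5 support N3 / §G-N4.2 (seat p3, gen 77). File 241 exhibits the generator `T_{g₀}` of the record's spherical
Hecke algebra (`g₀ ↦ P a₁ P⁻¹`, `a₁` the Cartan cell). Its DEGREE — the number of left cosets in the double coset
`K_v g₀ K_v` — is the printed `q⁴ + q = (q³ + 1) q` with `q = N(v)`: file 207's count of `#(K_U a₁ K_U / K_U)` on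
the completions (`ncard_orbit_cellU_eq_adicCompletion`, rows 11 / 11′ of T5-SATAKE-KERNEL-p3.md) is carried to the
record's own pair along the conjugation `U(J₃(u₀)) ≃* U(H_w)` (file 243's `conjMulEquiv`, matching the
hyperspecial subgroups since `P` is integral), the equality of the two spellings of `K_{H_w}`, and file 231's
`recordNonSplitEquiv'` (file 243's `ncard_orbit_eq_of_mulEquiv`, T5-144's image formula):

* **`exists_cell_doubleCosetOp_aeval_bijective_and_ncard_record`** — file 241's statement with the clause
  `#(K_v g₀ K_v / K_v) = (N(v)³ + 1) · N(v)` added, under file 232's hypotheses and `e(w/v) = 1`.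

§8(d): uses an L-value-free non-vanishing device: NO.
-/

open Matrix NumberField NumberField.IsCMField IsDedekindDomain IsDedekindDomain.HeightOneSpectrum Module Polynomial
  MulAction
open scoped TensorProduct Pointwise
open Summit.Ventures.HodgeRepro2.T5UnitaryGroupForm Summit.Ventures.HodgeRepro2.T5UnitaryHeckeAdjoint
  Summit.Ventures.HodgeRepro2.T5HeckePermutationModule Summit.Ventures.HodgeRepro2.T5StarOfInvolution
  Summit.Ventures.HodgeRepro2.T5FinitePlaceCM Summit.Ventures.HodgeRepro2.T5FinitePlaceNormIndex
  Summit.Ventures.HodgeRepro2.T5NonSplitPlaceUnitaryGroup Summit.Ventures.HodgeRepro2.T5RecordHyperspecial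
  Summit.Ventures.HodgeRepro2.T5GlobalLatticeAlmostAll Summit.Ventures.HodgeRepro2.T5HermitianLocalIsotropyN3
  Summit.Ventures.HodgeRepro2.T5FinitePlaceSplitClassification Summit.Ventures.HodgeRepro2.T5HermitianThreeElements
  Summit.Ventures.HodgeRepro2.T5GaloisCartanThree Summit.Ventures.HodgeRepro2.T5InertDegreeGalois
  Summit.Ventures.HodgeRepro2.T5InertDegreeCompletion Summit.Ventures.HodgeRepro2.T5InertPlaceCompletion
  Summit.Ventures.HodgeRepro2.T5InertDegreeAdicCompletion Summit.Ventures.HodgeRepro2.T5InertSatakeTransform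
  Summit.Ventures.HodgeRepro2.T5InertPlaceCompletionCells Summit.Ventures.HodgeRepro2.T5InertTopCoefficient
  Summit.Ventures.HodgeRepro2.T5SplitUnitaryGroupEquiv Summit.Ventures.HodgeRepro2.T5HeckeBasisCells
  Summit.Ventures.HodgeRepro2.T5HeckeDoubleCoset Summit.Ventures.HodgeRepro2.T5InertHeckeCells
  Summit.Ventures.HodgeRepro2.T5HeckeGeneratorTransport Summit.Ventures.HodgeRepro2.T5RecordSatake
  Summit.Ventures.HodgeRepro2.T5CartanCellsDistinct Summit.Ventures.HodgeRepro2.T5HeckeIsomorphismTransport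
  Summit.Ventures.HodgeRepro2.T5HeckeIsomorphismTransportCells Summit.Ventures.HodgeRepro2.T5SplitPlaceUnitaryGroup
  Summit.Ventures.HodgeRepro2.T5HeckeConjugationTransport Summit.Ventures.HodgeRepro2.T5RecordSatakeCell

namespace Summit.Ventures.HodgeRepro2.T5RecordSatakeDegree

section Record

variable (K : Type*) [Field K] [NumberField K] [IsCMField K]
variable (v : HeightOneSpectrum (𝓞 (maximalRealSubfield K))) (w : HeightOneSpectrum (𝓞 K))
  [w.asIdeal.LiesOver v.asIdeal]
  [IsDiscreteValuationRing (integralClosure (v.adicCompletionIntegers (maximalRealSubfield K)) (w.adicCompletion K))]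
  [Finite (IsLocalRing.ResidueField (integralClosure (v.adicCompletionIntegers (maximalRealSubfield K))
    (w.adicCompletion K)))]
  [IsFractionRing (integralClosure (v.adicCompletionIntegers (maximalRealSubfield K)) (w.adicCompletion K))
    (w.adicCompletion K)]
variable {θ : maximalRealSubfield K} {y : K}
  (hθ : algebraMap (maximalRealSubfield K) K θ = y ^ 2) (hy : complexConj K y ≠ y)
  (hsq : ¬ IsSquare (algebraMap (maximalRealSubfield K) (v.adicCompletion (maximalRealSubfield K)) θ))
  {ϖ : v.adicCompletionIntegers (maximalRealSubfield K)} (hϖ : Irreducible ϖ)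
  (hinert : Irreducible (algebraMap (v.adicCompletionIntegers (maximalRealSubfield K)) (w.adicCompletionIntegers K) ϖ))
variable {r : ℕ} (l : Fin r → 𝓞 K)

include hθ hy hsq hϖ hinert in
/-- **THE EXPLICIT GENERATOR AND ITS DEGREE**: file 241's generator `T_{g₀}` of `H(U(1 ⊗ H), K_v)` (`g₀ ↦ P a₁ P⁻¹`),
with `#(K_v g₀ K_v / K_v) = (N(v)³ + 1) · N(v) = N(v)⁴ + N(v)` — the printed degree of `T₁` (rows 11 / 11′ of
T5-SATAKE-KERNEL-p3.md) on the record's own pair, at an inert good place (`e(w/v) = 1`). -/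
theorem exists_cell_doubleCosetOp_aeval_bijective_and_ncard_record (k : Type*) [Field k]
    (hl : Submodule.span (𝓞 (maximalRealSubfield K)) (Set.range l) = ⊤)
    (he : v.asIdeal.ramificationIdx' w.asIdeal = 1)
    {H : Matrix (Fin 3) (Fin 3) K} (hH : H.IsHermitian) (hdet : IsUnit H.det) (hgood : w ∉ badSet H) :
    letI := tensorStarRing K v
    letI := starRingOfQuadratic (finrank_eq_two K v w hθ hy hsq)
      (localConj v w hθ.symm (span_pair_eq_top K hy) hsq (complexConj K))
      (localConj_ne_one v w hθ.symm (span_pair_eq_top K hy) hsq (complexConj K)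
        (complexConj_apply_eq_neg K hθ hy))
    ∃ (u₀ : (v.adicCompletionIntegers (maximalRealSubfield K))ˣ) (P : GL (Fin 3) (w.adicCompletion K))
      (g₀ : ↥(formUnitaryGroup (tensorGram K v H))),
      P ∈ (Matrix.GeneralLinearGroup.map (algebraMap
        (integralClosure (v.adicCompletionIntegers (maximalRealSubfield K)) (w.adicCompletion K))
        (w.adicCompletion K))).range ∧
      (P : Matrix (Fin 3) (Fin 3) (w.adicCompletion K))ᴴ * H.map (algebraMap K (w.adicCompletion K)) * P =
        J3 (algebraMap (v.adicCompletionIntegers (maximalRealSubfield K)) (w.adicCompletion K)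
          (u₀ : v.adicCompletionIntegers (maximalRealSubfield K))) ∧
      ((recordNonSplitEquiv' K v w hθ hy hsq H g₀ : ↥(formUnitaryGroup (H.map (algebraMap K (w.adicCompletion K)))))
        : GL (Fin 3) (w.adicCompletion K)) =
        P * cell (irreducible_uniformiser (map_maximalIdeal_integralClosure_eq_of_irreducible v w hϖ hinert) hϖ) 1
          * P⁻¹ ∧
      (orbit (recordHyperspecial K v l H) (g₀ : _ ⧸ recordHyperspecial K v l H)).ncard =
        (Ideal.absNorm v.asIdeal ^ 3 + 1) * Ideal.absNorm v.asIdeal ∧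
      ∃ _ : Finite (orbit (recordHyperspecial K v l H) (g₀ : _ ⧸ recordHyperspecial K v l H)),
        Function.Bijective (aeval (doubleCosetOp k (recordHyperspecial K v l H) g₀) :
          k[X] →ₐ[k] heckeAlgebra k (recordHyperspecial K v l H)) := by
  letI := tensorStarRing K v
  letI := starRingOfQuadratic (finrank_eq_two K v w hθ hy hsq)
    (localConj v w hθ.symm (span_pair_eq_top K hy) hsq (complexConj K))
    (localConj_ne_one v w hθ.symm (span_pair_eq_top K hy) hsq (complexConj K)
      (complexConj_apply_eq_neg K hθ hy))
  -- the local data (as in file 232)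
  have hst : ∀ x : w.adicCompletion K,
      star x = localConj v w hθ.symm (span_pair_eq_top K hy) hsq (complexConj K) x := fun x => by
    rw [star_p8_eq_star K v w hθ hy hsq]
    rfl
  have hHw := isHermitian_map_p8 K v w hθ hy hsq hH
  have hdetw : IsUnit (H.map (algebraMap K (w.adicCompletion K))).det := isUnit_det_map _ H hdet
  have hint : ∀ i j, IsLocalization.IsInteger
      (integralClosure (v.adicCompletionIntegers (maximalRealSubfield K)) (w.adicCompletion K))
      ((H.map (algebraMap K (w.adicCompletion K))) i j) := fun i j => by
    rw [isInteger_integralClosure_iff_of_isIntegralClosure (A := w.adicCompletionIntegers K), Matrix.map_apply]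
    exact isInteger_of_notMem_badSet hgood i j
  have hint' : ∀ i j, IsLocalization.IsInteger
      (integralClosure (v.adicCompletionIntegers (maximalRealSubfield K)) (w.adicCompletion K))
      ((H.map (algebraMap K (w.adicCompletion K)))⁻¹ i j) := fun i j => by
    rw [isInteger_integralClosure_iff_of_isIntegralClosure (A := w.adicCompletionIntegers K), inv_map _ H hdet,
      Matrix.map_apply]
    exact isInteger_inv_of_notMem_badSet hgood i j
  have h3 : 2 < Fintype.card (Fin 3) := by rw [Fintype.card_fin]; norm_num
  have hiso := exists_sesqForm_eq_zero_localConj v w hθ.symm (span_pair_eq_top K hy) hsq (complexConj K)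
    (complexConj_apply_eq_neg K hθ hy) (finrank_eq_two K v w hθ hy hsq) (ι := Fin 3) h3
    (H := H.map (algebraMap K (w.adicCompletion K))) hHw hdetw
  obtain ⟨x, hx0, hx⟩ := hiso
  -- the two spellings of `K_{H_w}`
  have hK : hyperspecialSubgroup (integralClosure (v.adicCompletionIntegers (maximalRealSubfield K))
      (w.adicCompletion K)) (H.map (algebraMap K (w.adicCompletion K))) =
      hyperspecialSubgroup (w.adicCompletionIntegers K) (H.map (algebraMap K (w.adicCompletion K))) :=
    hyperspecialSubgroup_integralClosure_eq (R := v.adicCompletionIntegers (maximalRealSubfield K))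
      (A := w.adicCompletionIntegers K) _
  -- seat p8's T5-145 on the completions: the change of basis `P`, the unit `u₀`, the transport `ε`
  refine (exists_algEquiv_doubleCosetOp_of_isotropic_of_unramified
    (v.adicCompletionIntegers (maximalRealSubfield K)) (v.adicCompletion (maximalRealSubfield K))
    (w.adicCompletion K) (finrank_eq_two K v w hθ hy hsq)
    (localConj v w hθ.symm (span_pair_eq_top K hy) hsq (complexConj K))
    (localConj_ne_one v w hθ.symm (span_pair_eq_top K hy) hsq (complexConj K) (complexConj_apply_eq_neg K hθ hy))
    (map_maximalIdeal_integralClosure_eq_of_irreducible v w hϖ hinert)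
    (H.map (algebraMap K (w.adicCompletion K))) k hHw hint hdetw hint' x hx0 hx).elim fun u₀ h1 =>
    h1.elim fun P h2 => h2.2.2.elim fun ε hε => ?_
  have hP := h2.1
  have hPHP := h2.2.1
  -- the cell `a₁` of `U(J₃(u₀))` and file 187's generator statement
  have hϖ' := irreducible_uniformiser (map_maximalIdeal_integralClosure_eq_of_irreducible v w hϖ hinert) hϖ
  have hs := star_algebraMap_of_star_eq (localConj v w hθ.symm (span_pair_eq_top K hy) hsq (complexConj K)) hst ϖ
  have hb0 := aeval_bijective
    (R := integralClosure (v.adicCompletionIntegers (maximalRealSubfield K)) (w.adicCompletion K))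
    (hstar_of_star_eq (localConj v w hθ.symm (span_pair_eq_top K hy) hsq (complexConj K)) hst)
    (algebraMap (v.adicCompletionIntegers (maximalRealSubfield K)) (w.adicCompletion K)
      (u₀ : v.adicCompletionIntegers (maximalRealSubfield K)))
    (star_algebraMap_of_star_eq (localConj v w hθ.symm (span_pair_eq_top K hy) hsq (complexConj K)) hst _)
    (algebraMap_unit_ne_zero (F := v.adicCompletion (maximalRealSubfield K)) u₀)
    (isInteger_algebraMap (u₀ : v.adicCompletionIntegers (maximalRealSubfield K)))
    (isInteger_algebraMap_unit_inv u₀) hϖ' hs k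
  have hb0' := bijective_aeval_of_eq (heckeBasisCells_apply
    (R := integralClosure (v.adicCompletionIntegers (maximalRealSubfield K)) (w.adicCompletion K))
    (hstar_of_star_eq (localConj v w hθ.symm (span_pair_eq_top K hy) hsq (complexConj K)) hst)
    (algebraMap (v.adicCompletionIntegers (maximalRealSubfield K)) (w.adicCompletion K)
      (u₀ : v.adicCompletionIntegers (maximalRealSubfield K)))
    (star_algebraMap_of_star_eq (localConj v w hθ.symm (span_pair_eq_top K hy) hsq (complexConj K)) hst _)
    (algebraMap_unit_ne_zero (F := v.adicCompletion (maximalRealSubfield K)) u₀)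
    (isInteger_algebraMap (u₀ : v.adicCompletionIntegers (maximalRealSubfield K)))
    (isInteger_algebraMap_unit_inv u₀) hϖ' hs k 1) hb0
  -- the conjugate cell in `U(H_w)`
  have hg'mem : P * (cellU hϖ' hs (algebraMap (v.adicCompletionIntegers (maximalRealSubfield K))
      (w.adicCompletion K) (u₀ : v.adicCompletionIntegers (maximalRealSubfield K))) 1 :
        GL (Fin 3) (w.adicCompletion K)) * P⁻¹ ∈ formUnitaryGroup (H.map (algebraMap K (w.adicCompletion K))) :=
    conj_mem_formUnitaryGroup P hPHP (cellU hϖ' hs _ 1).2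
  let g' : ↥(formUnitaryGroup (H.map (algebraMap K (w.adicCompletion K)))) := ⟨_, hg'mem⟩
  have hg' : (g' : GL (Fin 3) (w.adicCompletion K)) = P * (cellU hϖ' hs (algebraMap
      (v.adicCompletionIntegers (maximalRealSubfield K)) (w.adicCompletion K)
      (u₀ : v.adicCompletionIntegers (maximalRealSubfield K))) 1 : GL (Fin 3) (w.adicCompletion K)) * P⁻¹ := rfl
  haveI := finite_orbit (R := integralClosure (v.adicCompletionIntegers (maximalRealSubfield K))
    (w.adicCompletion K)) _ (cellU hϖ' hs (algebraMap (v.adicCompletionIntegers (maximalRealSubfield K))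
      (w.adicCompletion K) (u₀ : v.adicCompletionIntegers (maximalRealSubfield K))) 1)
  haveI := finite_orbit (R := integralClosure (v.adicCompletionIntegers (maximalRealSubfield K))
    (w.adicCompletion K)) _ g'
  have hεg := hε _ g' hg'
  -- `T_{g'}` generates `H(U(H_w), K_{H_w})`, first over the integral closure, then over `𝒪_w`
  have hb1 := bijective_aeval_of_eq hεg (bijective_aeval_algEquiv_apply ε hb0')
  haveI := finite_orbit (R := w.adicCompletionIntegers K) _ g'
  have hb2 := bijective_aeval_doubleCosetOp_of_eq k hK g' hb1
  -- back to the record's pair along `recordNonSplitEquiv'`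
  have hKφ := mem_recordHyperspecial_iff_nonSplit K v w hθ hy hsq l hl H
  haveI := finite_orbit (R := w.adicCompletionIntegers K) _
    (recordNonSplitEquiv' K v w hθ hy hsq H ((recordNonSplitEquiv' K v w hθ hy hsq H).symm g'))
  haveI hfin := finite_orbit_of_mulEquiv (recordNonSplitEquiv' K v w hθ hy hsq H) hKφ
    ((recordNonSplitEquiv' K v w hθ hy hsq H).symm g')
  -- the degree: file 207's count on `U(J₃(u₀))`, carried along the conjugation and `recordNonSplitEquiv'`
  have hdeg0 := ncard_orbit_cellU_eq_adicCompletion v w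
    (localConj v w hθ.symm (span_pair_eq_top K hy) hsq (complexConj K)) hst he (finrank_eq_two K v w hθ hy hsq)
    (localConj_ne_one v w hθ.symm (span_pair_eq_top K hy) hsq (complexConj K) (complexConj_apply_eq_neg K hθ hy))
    hϖ hinert u₀ 1 le_rfl
  have hc1 := ncard_orbit_eq_of_mulEquiv (conjMulEquiv P hPHP)
    (mem_hyperspecialSubgroup_conjMulEquiv_iff (R := integralClosure (v.adicCompletionIntegers (maximalRealSubfield K))
      (w.adicCompletion K)) P hPHP hP)
    (cellU hϖ' hs (algebraMap (v.adicCompletionIntegers (maximalRealSubfield K)) (w.adicCompletion K)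
      (u₀ : v.adicCompletionIntegers (maximalRealSubfield K))) 1)
  have hc2 : conjMulEquiv P hPHP (cellU hϖ' hs (algebraMap (v.adicCompletionIntegers (maximalRealSubfield K))
      (w.adicCompletion K) (u₀ : v.adicCompletionIntegers (maximalRealSubfield K))) 1) = g' :=
    Subtype.ext ((conjMulEquiv_apply_coe P hPHP _).trans hg'.symm)
  have hc3 := ncard_orbit_eq_of_eq hK g'
  have hc4 := ncard_orbit_eq_of_mulEquiv (recordNonSplitEquiv' K v w hθ hy hsq H) hKφ
    ((recordNonSplitEquiv' K v w hθ hy hsq H).symm g')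
  rw [MulEquiv.apply_symm_apply] at hc4
  refine ⟨u₀, P, (recordNonSplitEquiv' K v w hθ hy hsq H).symm g', hP, hPHP, ?_, ?_, hfin,
    bijective_aeval_doubleCosetOp_symm k (recordNonSplitEquiv' K v w hθ hy hsq H) hKφ g' hb2⟩
  · rw [MulEquiv.apply_symm_apply, hg', coe_cellU]
  · rw [hc4, ← hc3, ← hc2, ← hc1, hdeg0]
    norm_num

end Record

end Summit.Ventures.HodgeRepro2.T5RecordSatakeDegree
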